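import Literature.Probability.Percolation.DecisionTreeWeighted
import Literature.Probability.LatticeModels.RandomClusterFKG
import Mathlib.Combinatorics.SimpleGraph.Connectivity.Connected
import Mathlib.Algebra.BigOperators.Group.Finset.Powerset
import HarnessLib

/-!
# `NoHeavyLowerTail` (stmt-CriticalPhenomena-4575) — SHK3⁺ / 3PT-LB terminal-edge induction, part 1: sections of the three-point cells

Support file (prover prim-ineq-prove-2 gen 2; `--supports stmt-CriticalPhenomena-4575`).  Finitary weighted-cube calculus of
`DecisionTreeWeighted.lean`: configurations `S ⊆ D` of OPEN random edges (weights `wtW D p S`) plus a set `K` of FORCED edges; the open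
graph is `fromEdgeSet (S ∪ K)`.  This part: reachability `R K S x y` and its behaviour under forcing one more edge `e = {u,v}`
(`reach_insert_cases`, via the tree's `reachable_sup_edge_imp`: a walk either avoids `e` or crosses it), the five three-point cells `evQ, evU₁ (ab|c), evU₂ (ac|b), evU₃ (bc|a), evT`
(the convention of `CubicThreePointNoGo` / `CubicThreePointBernsteinStep`), the APEX facts `gain_bc`, `gain_both`, `gain_a` (with `x` joined to the
apex `a`: a `b–c` connection gained through `e = {x,m}` passes through `a`; `a–b` and `a–c` cannot both be gained unless `b ~ c` already),
additivity of `PrW` from pointwise indicator identities, the ONE-EDGE SPLIT `PrW_split`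
(`PrW_{D∪{e}}(X) = (1−p_e)PrW_D(X) + p_e PrW_D({S | S∪{e} ∈ X})`) and `sect_ev*` (the `{e}∪·`-section of a cell of `K` is the cell of `K∪{e}`).
Part 2 (`…CubicThreePointTransitions`) turns the apex facts into the five transition identities; part 3 (`…CubicThreePointInduction`) runs the
induction modulo the Bernstein step.  Memo: run/shared/lean/prim/prim-ineq-prove-2/MEMO-7-3PTLB-INDUCTION.md.
[cite: GladkovZimin2024HK, §4 (coordinate induction / one-edge split)]; [cite: Gladkov2024StrongFKG, Cor. 4.2 (the three-point cells)]
-/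

noncomputable section

namespace Summit.CriticalPhenomena.PercolationContinuityZ3.Theorems

namespace CubicThreePointStep

open Finset SimpleGraph Literature.Probability.Percolation.DecisionTree

variable {V : Type*} [DecidableEq V]

/-! ### Reachability in the open graph of a configuration with forced edges -/

/-- `R F S x y`: `x` and `y` are joined by a path of edges of `S ∪ F` (open random edges `S`, forced edges `F`). [folklore] -/
def R (K S : Finset (Sym2 V)) (x y : V) : Prop :=
  (fromEdgeSet (↑(S ∪ K) : Set (Sym2 V))).Reachable x y

/-- `R` is reflexive. [folklore] -/
theorem R_refl (K S : Finset (Sym2 V)) (x : V) : R K S x x := Reachable.refl _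
/-- `R` is symmetric. [folklore] -/
theorem R.symm {K S : Finset (Sym2 V)} {x y : V} (h : R K S x y) : R K S y x := Reachable.symm h
/-- `R` is transitive. [folklore] -/
theorem R.trans {K S : Finset (Sym2 V)} {x y z : V} (h : R K S x y) (h' : R K S y z) : R K S x z :=
  Reachable.trans h h'

/-- Monotonicity in the forced set: forcing one more edge keeps reachability. [folklore] -/
theorem R_mono_insert {K S : Finset (Sym2 V)} (e : Sym2 V) {x y : V} (h : R K S x y) : R (insert e K) S x y := by
  unfold R at h ⊢
  refine h.mono (fromEdgeSet_mono ?_)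
  intro z hz
  simp only [Finset.coe_union, Set.mem_union, Finset.mem_coe] at hz ⊢
  rcases hz with hz | hz
  · exact Or.inl hz
  · exact Or.inr (Finset.mem_insert_of_mem hz)

/-- Monotonicity in the configuration: more open edges keep reachability. [folklore] -/
theorem R_mono_config {K S S' : Finset (Sym2 V)} (hS : S ⊆ S') {x y : V} (h : R K S x y) : R K S' x y := by
  unfold R at h ⊢
  refine h.mono (fromEdgeSet_mono ?_)
  intro z hz
  simp only [Finset.coe_union, Set.mem_union, Finset.mem_coe] at hz ⊢
  rcases hz with hz | hz
  · exact Or.inl (hS hz)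
  · exact Or.inr hz

/-- The open graph with `e = {u,v}` forced is the open graph plus the edge `uv`. [folklore] -/
theorem fromEdgeSet_insert_eq (K S : Finset (Sym2 V)) (u v : V) :
    fromEdgeSet (↑(S ∪ insert s(u, v) K) : Set (Sym2 V)) = fromEdgeSet (↑(S ∪ K) : Set (Sym2 V)) ⊔ edge u v := by
  rw [Finset.union_insert, Finset.coe_insert, Set.insert_eq, fromEdgeSet_union, sup_comm]
  rfl

/-- Crossing the forced edge `e = {u,v}`: reachability in `S ∪ F ∪ {e}` either holds in `S ∪ F` or passes through `u, v`. [folklore] -/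
theorem reach_insert_cases {K S : Finset (Sym2 V)} {u v x y : V} (h : R (insert s(u, v) K) S x y) :
    R K S x y ∨ (R K S x u ∧ R K S v y) ∨ (R K S x v ∧ R K S u y) := by
  unfold R at h
  rw [fromEdgeSet_insert_eq] at h
  exact Literature.Probability.LatticeModels.reachable_sup_edge_imp _ u v h

/-- The forced edge `e = {u,v}` (with `u ≠ v`) joins `u` and `v`. [folklore] -/
theorem R_insert_edge {K S : Finset (Sym2 V)} {u v : V} (huv : u ≠ v) : R (insert s(u, v) K) S u v := by
  unfold R
  rw [fromEdgeSet_insert_eq]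
  refine Adj.reachable ?_
  rw [sup_adj, edge_adj]
  exact Or.inr ⟨Or.inl ⟨rfl, rfl⟩, huv⟩

/-! ### The five cells (three-point partition events) and their weighted masses -/

variable (K : Finset (Sym2 V)) (a b c : V)

/-- `abc`: all three terminals joined. [folklore] -/
def evT : Set (Finset (Sym2 V)) := {S | R K S a b ∧ R K S a c}
/-- `ab|c`. [folklore] -/
def evU₁ : Set (Finset (Sym2 V)) := {S | R K S a b ∧ ¬ R K S a c}
/-- `ac|b`. [folklore] -/
def evU₂ : Set (Finset (Sym2 V)) := {S | R K S a c ∧ ¬ R K S a b}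
/-- `bc|a`. [folklore] -/
def evU₃ : Set (Finset (Sym2 V)) := {S | R K S b c ∧ ¬ R K S a b}
/-- `a|b|c`: all three separated. [folklore] -/
def evQ : Set (Finset (Sym2 V)) := {S | ¬ R K S a b ∧ ¬ R K S a c ∧ ¬ R K S b c}

variable {K a b c}

/-- Membership in `evT`. [folklore] -/
@[simp] theorem mem_evT {S} : S ∈ evT K a b c ↔ R K S a b ∧ R K S a c := Iff.rfl
/-- Membership in `evU₁`. [folklore] -/
@[simp] theorem mem_evU₁ {S} : S ∈ evU₁ K a b c ↔ R K S a b ∧ ¬ R K S a c := Iff.rfl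
/-- Membership in `evU₂`. [folklore] -/
@[simp] theorem mem_evU₂ {S} : S ∈ evU₂ K a b c ↔ R K S a c ∧ ¬ R K S a b := Iff.rfl
/-- Membership in `evU₃`. [folklore] -/
@[simp] theorem mem_evU₃ {S} : S ∈ evU₃ K a b c ↔ R K S b c ∧ ¬ R K S a b := Iff.rfl
/-- Membership in `evQ`. [folklore] -/
@[simp] theorem mem_evQ {S} : S ∈ evQ K a b c ↔ ¬ R K S a b ∧ ¬ R K S a c ∧ ¬ R K S b c := Iff.rfl

/-! ### The apex transition structure along `e = {x, m}` with `x` forced-joined to the apex `a` -/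

section Apex

variable {S : Finset (Sym2 V)} {x m : V} (hax : R K S a x)
include hax

/-- (S1) A `b–c` connection gained through the apex edge passes through `a`. [folklore] -/
theorem gain_bc (hbc1 : R (insert s(x, m) K) S b c) (hbc0 : ¬ R K S b c) :
    R (insert s(x, m) K) S a b ∧ R (insert s(x, m) K) S a c := by
  rcases reach_insert_cases hbc1 with h | ⟨h1, h2⟩ | ⟨h1, h2⟩
  · exact absurd h hbc0
  · -- b ~ x and m ~ c
    refine ⟨R_mono_insert _ (hax.trans h1.symm), ?_⟩
    exact (R_mono_insert _ (hax.trans h1.symm)).trans hbc1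
  · refine ⟨?_, R_mono_insert _ (hax.trans h2)⟩
    exact (R_mono_insert _ (hax.trans h2)).trans hbc1.symm

/-- (S2) If both `a–b` and `a–c` are gained through the apex edge then `b ~ c` already. [folklore] -/
theorem gain_both (hab1 : R (insert s(x, m) K) S a b) (hab0 : ¬ R K S a b)
    (hac1 : R (insert s(x, m) K) S a c) (hac0 : ¬ R K S a c) : R K S b c := by
  have hmb : R K S m b := by
    rcases reach_insert_cases hab1 with h | ⟨_, h2⟩ | ⟨_, h2⟩
    · exact absurd h hab0
    · exact h2
    · exact absurd (hax.trans h2) hab0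
  have hmc : R K S m c := by
    rcases reach_insert_cases hac1 with h | ⟨_, h2⟩ | ⟨_, h2⟩
    · exact absurd h hac0
    · exact h2
    · exact absurd (hax.trans h2) hac0
  exact hmb.symm.trans hmc

/-- A connection to `a` gained through the apex edge comes from `m`'s old cluster. [folklore] -/
theorem gain_a {y : V} (h1 : R (insert s(x, m) K) S a y) (h0 : ¬ R K S a y) : R K S m y := by
  rcases reach_insert_cases h1 with h | ⟨_, h2⟩ | ⟨_, h2⟩
  · exact absurd h h0
  · exact h2
  · exact absurd (hax.trans h2) h0

end Apex

/-! ### Weighted masses: additivity from pointwise indicator identities, one-edge split -/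

section Weights

variable (D : Finset (Sym2 V)) (p : Sym2 V → ℝ)

/-- Events with equal indicators on configurations `⊆ D` have equal mass. [folklore] -/
theorem PrW_of_ind_eq {A B : Set (Finset (Sym2 V))} (h : ∀ S, S ⊆ D → ind A S = ind B S) :
    PrW D p A = PrW D p B := by
  rw [PrW_eq_sum_ind, PrW_eq_sum_ind]
  exact Finset.sum_congr rfl fun S hS => by rw [h S (Finset.mem_powerset.1 hS)]

/-- Additivity of `PrW` from a pointwise indicator identity (two pieces). [folklore] -/
theorem PrW_of_ind_add {A B C : Set (Finset (Sym2 V))} (h : ∀ S, S ⊆ D → ind A S = ind B S + ind C S) :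
    PrW D p A = PrW D p B + PrW D p C := by
  rw [PrW_eq_sum_ind, PrW_eq_sum_ind, PrW_eq_sum_ind, ← Finset.sum_add_distrib]
  exact Finset.sum_congr rfl fun S hS => by rw [h S (Finset.mem_powerset.1 hS)]; ring

/-- Additivity of `PrW` from a pointwise indicator identity (three pieces). [folklore] -/
theorem PrW_of_ind_add3 {A B C E : Set (Finset (Sym2 V))}
    (h : ∀ S, S ⊆ D → ind A S = ind B S + ind C S + ind E S) :
    PrW D p A = PrW D p B + PrW D p C + PrW D p E := by
  rw [PrW_eq_sum_ind, PrW_eq_sum_ind, PrW_eq_sum_ind, PrW_eq_sum_ind, ← Finset.sum_add_distrib,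
    ← Finset.sum_add_distrib]
  exact Finset.sum_congr rfl fun S hS => by rw [h S (Finset.mem_powerset.1 hS)]; ring

/-- Additivity of `PrW` from a pointwise indicator identity (four pieces). [folklore] -/
theorem PrW_of_ind_add4 {A B C E G : Set (Finset (Sym2 V))}
    (h : ∀ S, S ⊆ D → ind A S = ind B S + ind C S + ind E S + ind G S) :
    PrW D p A = PrW D p B + PrW D p C + PrW D p E + PrW D p G := by
  rw [PrW_eq_sum_ind, PrW_eq_sum_ind, PrW_eq_sum_ind, PrW_eq_sum_ind, PrW_eq_sum_ind,
    ← Finset.sum_add_distrib, ← Finset.sum_add_distrib, ← Finset.sum_add_distrib]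
  exact Finset.sum_congr rfl fun S hS => by rw [h S (Finset.mem_powerset.1 hS)]; ring

/-- `PrW` of an event containing every configuration is `1`. [folklore] -/
theorem PrW_eq_one_of_forall {A : Set (Finset (Sym2 V))} (h : ∀ S, S ⊆ D → S ∈ A) : PrW D p A = 1 := by
  rw [← PrW_univ D p]
  exact PrW_of_ind_eq D p fun S hS => by rw [ind_of_mem (h S hS), ind_of_mem (Set.mem_univ _)]

/-- `PrW` of an event containing no configuration is `0`. [folklore] -/
theorem PrW_eq_zero_of_forall {A : Set (Finset (Sym2 V))} (h : ∀ S, S ⊆ D → S ∉ A) : PrW D p A = 0 := by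
  rw [PrW_eq_sum_ind]
  exact Finset.sum_eq_zero fun S hS => by rw [ind_of_not_mem (h S (Finset.mem_powerset.1 hS)), mul_zero]

/-- **One-edge split** of a weighted mass: expose the coordinate `e ∉ D`.
`PrW_{D ∪ {e}}(X) = (1 − p_e)·PrW_D(X) + p_e·PrW_D({S | S ∪ {e} ∈ X})`. [cite: GladkovZimin2024HK, §4 (proof of Thm. 4.3)] -/
theorem PrW_split {e : Sym2 V} (he : e ∉ D) (X : Set (Finset (Sym2 V))) :
    PrW (insert e D) p X = (1 - p e) * PrW D p X + p e * PrW D p {S | insert e S ∈ X} := by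
  rw [PrW_eq_sum_ind, PrW_eq_sum_ind, PrW_eq_sum_ind, Finset.sum_powerset_insert he, Finset.mul_sum,
    Finset.mul_sum]
  congr 1
  · refine Finset.sum_congr rfl fun S hS => ?_
    have heS : e ∉ S := fun h => he (Finset.mem_powerset.1 hS h)
    have hw : wtW (insert e D) p S = (1 - p e) * wtW D p S := by
      unfold wtW
      rw [Finset.prod_insert he, if_neg heS]
    rw [hw, mul_assoc]
  · refine Finset.sum_congr rfl fun S _ => ?_
    have hw : wtW (insert e D) p (insert e S) = p e * wtW D p S := by
      unfold wtW
      rw [Finset.prod_insert he, if_pos (Finset.mem_insert_self e S)]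
      congr 1
      refine Finset.prod_congr rfl fun i hi => ?_
      have hie : i ≠ e := fun h => he (h ▸ hi)
      simp only [Finset.mem_insert, hie, false_or]
    have hind : ind X (insert e S) = ind {S' : Finset (Sym2 V) | insert e S' ∈ X} S := by
      by_cases hm : insert e S ∈ X
      · rw [ind_of_mem hm, ind_of_mem (show S ∈ {S' : Finset (Sym2 V) | insert e S' ∈ X} from hm)]
      · rw [ind_of_not_mem hm, ind_of_not_mem (show S ∉ {S' : Finset (Sym2 V) | insert e S' ∈ X} from hm)]
    rw [hw, hind, mul_assoc]

end Weights

/-- Forcing `e` is the same as opening it: `R K (S ∪ {e}) = R (K ∪ {e}) S`. [folklore] -/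
theorem R_insert_config_iff (K S : Finset (Sym2 V)) (e : Sym2 V) (x y : V) :
    R K (insert e S) x y ↔ R (insert e K) S x y := by
  unfold R
  rw [Finset.insert_union, Finset.union_insert]

/-- The `{e} ∪ ·`-sections of the five cells of `K` are the five cells of `K ∪ {e}`. [folklore] -/
theorem sect_evT (K : Finset (Sym2 V)) (a b c : V) (e : Sym2 V) :
    {S | insert e S ∈ evT K a b c} = evT (insert e K) a b c := by
  ext S; simp only [Set.mem_setOf_eq, mem_evT, R_insert_config_iff]
/-- The `{e} ∪ ·`-section of the cell `ab|c` of `K` is the cell of `K ∪ {e}`. [folklore] -/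
theorem sect_evU₁ (K : Finset (Sym2 V)) (a b c : V) (e : Sym2 V) :
    {S | insert e S ∈ evU₁ K a b c} = evU₁ (insert e K) a b c := by
  ext S; simp only [Set.mem_setOf_eq, mem_evU₁, R_insert_config_iff]
/-- The `{e} ∪ ·`-section of the cell `ac|b` of `K` is the cell of `K ∪ {e}`. [folklore] -/
theorem sect_evU₂ (K : Finset (Sym2 V)) (a b c : V) (e : Sym2 V) :
    {S | insert e S ∈ evU₂ K a b c} = evU₂ (insert e K) a b c := by
  ext S; simp only [Set.mem_setOf_eq, mem_evU₂, R_insert_config_iff]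
/-- The `{e} ∪ ·`-section of the cell `bc|a` of `K` is the cell of `K ∪ {e}`. [folklore] -/
theorem sect_evU₃ (K : Finset (Sym2 V)) (a b c : V) (e : Sym2 V) :
    {S | insert e S ∈ evU₃ K a b c} = evU₃ (insert e K) a b c := by
  ext S; simp only [Set.mem_setOf_eq, mem_evU₃, R_insert_config_iff]
/-- The `{e} ∪ ·`-section of the cell `a|b|c` of `K` is the cell of `K ∪ {e}`. [folklore] -/
theorem sect_evQ (K : Finset (Sym2 V)) (a b c : V) (e : Sym2 V) :
    {S | insert e S ∈ evQ K a b c} = evQ (insert e K) a b c := by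
  ext S; simp only [Set.mem_setOf_eq, mem_evQ, R_insert_config_iff]


end CubicThreePointStep

end Summit.CriticalPhenomena.PercolationContinuityZ3.Theorems
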